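import Summits.QuantumFields.BalabanUV.Beta.AxialDressingRootedBmKernel

/-!
# `BalabanUV.Beta.AxialDressingSlot` — binder row D1, row HP-SYM-SLOTS «SLOT-DRESS» (RULING R-D1-g25-2 (3)): the GAUGE-PARAMETER SLOT of the
# block-mean projector kernel and its dressings — `pmOf g`, `piKOf g N`, `dressKOf g N K := Π̂∘K∘Π̂ᵀ`, `coDressKOf g N K := Π̂ᵀ∘K∘Π̂` for an ARBITRARY gauge
# `g : Form1 (d+1) ℝ → Form0 (d+1) ℝ`, with the comb instance `g := (A ↦ bmGaugeAt ρ A N)` recovered BY `rfl` (`piKOf_bmGaugeAt`, `coDressKOf_bmGaugeAt`)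

HONEST FRAMING (cell charter, verbatim): «discharging `BetaPertH` makes Bałaban's UV stability UNCONDITIONAL — a real constructive-QFT result;
it is NOT the continuum limit and NOT the Clay problem.»  DERIVED cell leaf (pub-balaban β sub-cell, binder row D1; CROSS-CELL idle-seat kernel duty of
the T⁴∕NE5 leaf seat `b2b-balaban-t4-ne5-formalise-leaf-05`, gen 29, under the row-D1 owner's RULING R-D1-g25-2 (3) «TABLE SLOTS … CLAIMABLE leaf work
NOW … then any idle seat»).  Kernel bookkeeping of OUR objects: four definitions and `[folklore]` lemmas about them; no statement of Bałaban's papers is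
typed, no `[cite:]` tag, no `def … : Prop`; the landed modules `AxialDressingRootedBm*` stay BYTE-IDENTICAL and nothing is re-pointed.  It instantiates NO
binder of the β-function wall.  NOT D1, NOT `BetaPertH`, NOT continuum, NOT Clay.
HONEST DEPENDENCY (cell records, verbatim): «continuum YM on T⁴ ⇐ BetaPertH ∧ nine spine estimates (0/9 proved); BetaPertH ⇐ (D1) ∧ (D4) ∧ CAP+tail;
G-an2-4 gates asym, D1 and NE2/3/4.»
ABSOLUTE RULE (cell charter, verbatim): «No internally-minted statement may enter as a cited fact. Every hypothesis is either kernel-proved in this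
package or a verbatim quotation of a PUBLISHED theorem with page reference. The manuscript(s) under audit are NOT citable for their own disputed steps —
they are the thing under adjudication; programme-internal (2001/route/tribunal) claims are never citable.»

## Why (R-D1-g25-2 (1)+(3)) and what is here
Every JsB12Sym table is the comb FORMULA with the comb's root-reading data replaced by σ-means.  In an2's `AxialDressingRootedBmKernel` the ONE
comb-hard-wired datum of `piKBm ρ N` ∕ `coDressKBmAt ρ N K` is the GAUGE `A ↦ bmGaugeAt ρ A N` inside `pmBm ρ N β p α q = (δ_{(α,q)} − d(bmGaugeAt ρ δ_{(α,q)} N)) β p`;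
window, identity multiplier block and `comp` sandwich are formula.  Here the gauge is a PARAMETER `g`, so every item below is SHARED between the comb
(`g := bmGaugeAt ρ · N`, §4, bridges by `rfl`) and any other gauge (an2's symmetrised block-mean gauge of JSB12SYM-SPINE (Σ2): its `pmSymBm`∕`piKSymBm`∕
`coDressKSymAt` are `pmOf`∕`piKOf`∕`coDressKOf` at that gauge by the same `rfl`s, `bondIndR α q` being `fun κ z ↦ (bondInd α q κ z : ℝ)`).
* §1 `pmOf g`, `piKOf g N` (entries, `sum_piKOf_col_inl`); over the displayed LETTERS (BND) `|pmOf g β p α q| ≤ B` (`1 ≤ B`) and (SH)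
  `pmOf g β (p + N•z) α (q + N•z) = pmOf g β p α q`: `decays_piKOf` (every rate, constant `cPOf d N B δ`; `cPOf_comb`), `spr_piKOf`, `spr_trK_piKOf`, `shiftK_piKOf`.
* §2 `dressKOf`, `coDressKOf` (comp form), `comp_piKOf_inr`, `colH_coDressKOf`, `decays_coDressKOf`, `spr_coDressKOf`, `shiftK_coDressKOf`.
* §3 over (RFL) `pmOf g b p a q = reflSign α a · reflSign α b · pmOf g b (bref α b p) a (bref α a q)`, (WIN) `pmOf g b p a q ≠ 0 → p − q ∈ cube`,
  (WIN′) `… → bref α b p − bref α a q ∈ cube`: `refK_piKOf`, `refK_coDressKOf`.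
* §4 THE COMB INSTANCE: `pmOf_bmGaugeAt`, `piKOf_bmGaugeAt`, `dressKOf_bmGaugeAt`, `coDressKOf_bmGaugeAt` (all `rfl`); the comb's letters BY NAME
  (`abs_pmBm_le`, `pmBm_shift`, `pmBm_refl`, `window[_refl]_of_pmBm_ne_zero`) so that `decays_piKOf`∕`shiftK_piKOf`∕`decays_coDressKOf`∕`shiftK_coDressKOf`∕`refK_piKOf`∕`refK_coDressKOf` FIRE at the comb gauge
  (`…_comb`; = the landed `decays_piKBm` … `refK_coDressKBmAt_KInvStep` up to the `rfl` bridges, which are NOT restated — consistency only, nothing new about the comb).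
NOT HERE: `permK`-covariance of the slot (an2's K1a-2 has it at the symmetrised instance), the `RelInv` rules (K1b∕K2), the integer-matrix dressing
`AxialDressingRootedKernel.piK`∕`dressKAt` over `pm`, any JsB12Sym instance or letter, any identification with Bałaban's (0.4) objects.
All declarations `[folklore]`; axioms standard.  Provenance: b2b-balaban, unit `b2b-balaban-t4-ne5-formalise-leaf-05` gen 29, 2026-08-21 (v1); a
parameter-generic REWRITE of `AxialDressingRootedBmKernel` §1–§3 (unit beta-an2 gen 12) with `hr ↦ letters`, nothing of it edited.
-/

open Finset
open scoped BigOperators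
open Literature.MathematicalPhysics.QuantumFieldTheory
open Literature.MathematicalPhysics.QuantumFieldTheory.Balaban1983to89
open Literature.MathematicalPhysics.QuantumFieldTheory.Balaban1983to89.Beta
open B12Sec2to5 (l1 l1_nonneg)
open ExpKernelCalculus (MKer Decays BiLoc comp tr shiftK l1_sub_symm)
open AffineAveraging (Form0 Form1 box toSite unitVec unitVec_apply blockSum)
open AveragingContours (blk grad shift)
open AveragingContoursRooted (treeGaugeAt ctrOff ctr ctrOff_mem_box)
open PolarizationSign (reflSign)
open KernelReflection (LegMap refK refK_apply comp_refK)
open ResolventReflection (sref bref bref_apply bref_bref mref mref_mref Φ Φ_r_inl Φ_r_inr Φ_s_inl Φ_s_inr reflSign_mul_self refK_KInvStep)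
open OneStepResolventKernel (Fib)
open OneStepKernelFamily (KInvStep decays_KInvStep shiftK_KInvStep colH)
open Summit.QuantumFields.BalabanUV.Beta.TameKernelCalculus
open Summit.QuantumFields.BalabanUV.Beta.AxialProjectorBlockMean (blockMeanAt bmGaugeAt axProjBmAt axProjBmAt_eq)

namespace Summit.QuantumFields.BalabanUV.Beta.AxialDressingRooted

noncomputable section

variable {d : ℕ}

/-! ## §1 The projector matrix and kernel over a gauge slot -/

section PiKOf

/-- [folklore] **THE MATRIX OF THE PROJECTOR `A ↦ A − d(g A)` ON BOND INDICATORS**, for an arbitrary gauge `g : Form1 → Form0`: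
`pmOf g β p α q := (δ_{(α,q)} − d(g δ_{(α,q)})) β p`.  At `g := (A ↦ bmGaugeAt ρ A N)` this is `pmBm ρ N` (`pmOf_bmGaugeAt`, `rfl`). -/
def pmOf (g : Form1 (d + 1) ℝ → Form0 (d + 1) ℝ) (β : Fin (d + 1)) (p : Fin (d + 1) → ℤ) (α : Fin (d + 1)) (q : Fin (d + 1) → ℤ) : ℝ :=
  ((fun κ z => (bondInd α q κ z : ℝ)) - grad (g fun κ z => (bondInd α q κ z : ℝ))) β p

/-- [folklore] **THE WINDOWED PROJECTOR KERNEL OVER A GAUGE SLOT** `piKOf g N`: field block `[x′ − x ∈ cube]·pmOf g β x′ α x`, multiplier block the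
identity, mixed blocks `0` — `piKBm` with `pmBm ↦ pmOf g`. -/
def piKOf (g : Form1 (d + 1) ℝ → Form0 (d + 1) ℝ) (N : ℕ) : MKer (d + 1) (Fib d) :=
  fun x x' a b =>
    match a, b with
    | Sum.inl α, Sum.inl β => if x' - x ∈ cube (d + 1) N then pmOf g β x' α x else 0
    | Sum.inl _, Sum.inr _ => 0
    | Sum.inr _, Sum.inl _ => 0
    | Sum.inr m, Sum.inr m' => if x = x' ∧ m = m' then 1 else 0

variable (g : Form1 (d + 1) ℝ → Form0 (d + 1) ℝ) (N : ℕ)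

/-- [folklore] Field–field entry. -/
theorem piKOf_inl_inl (x x' : Fin (d + 1) → ℤ) (α β : Fin (d + 1)) :
    piKOf g N x x' (Sum.inl α) (Sum.inl β) = if x' - x ∈ cube (d + 1) N then pmOf g β x' α x else 0 := rfl

/-- [folklore] Field–multiplier entry vanishes. -/
theorem piKOf_inl_inr (x x' : Fin (d + 1) → ℤ) (α m : Fin (d + 1)) : piKOf g N x x' (Sum.inl α) (Sum.inr m) = 0 := rfl

/-- [folklore] Multiplier–field entry vanishes. -/
theorem piKOf_inr_inl (x x' : Fin (d + 1) → ℤ) (m α : Fin (d + 1)) : piKOf g N x x' (Sum.inr m) (Sum.inl α) = 0 := rfl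

/-- [folklore] Multiplier–multiplier entry is the identity. -/
theorem piKOf_inr_inr (x x' : Fin (d + 1) → ℤ) (m m' : Fin (d + 1)) :
    piKOf g N x x' (Sum.inr m) (Sum.inr m') = if x = x' ∧ m = m' then 1 else 0 := rfl

/-- [folklore] Column contraction, field column: a windowed `pmOf`-sum. -/
theorem sum_piKOf_col_inl (u u' : Fin (d + 1) → ℤ) (κ' : Fin (d + 1)) (h : Fib d → ℝ) :
    ∑ f : Fib d, piKOf g N u u' f (Sum.inl κ') * h f =
      if u' - u ∈ cube (d + 1) N then ∑ κ : Fin (d + 1), pmOf g κ' u' κ u * h (Sum.inl κ) else 0 := by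
  rw [Fintype.sum_sum_type]
  simp only [piKOf_inl_inl, piKOf_inr_inl, zero_mul, Finset.sum_const_zero, add_zero]
  split_ifs
  · rfl
  · simp

/-- [folklore] The decay constant of `piKOf` at rate `δ` for a matrix bound `B`: `cPOf d N B δ := B · e^{δ(d+1)N}`. -/
def cPOf (d N : ℕ) (B δ : ℝ) : ℝ := B * Real.exp (δ * (((d : ℝ) + 1) * N))

/-- [folklore] The comb constant is the slot constant at `B = 1 + 4(d+1)N`. -/
theorem cPOf_comb (d N : ℕ) (δ : ℝ) : cPOf d N (1 + 4 * (((d : ℝ) + 1) * N)) δ = cPb d N δ := rfl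

variable {g N}

/-- [folklore] `0 ≤ cPOf` for `B ≥ 0`. -/
theorem cPOf_nonneg {B : ℝ} (hB : 0 ≤ B) (δ : ℝ) : 0 ≤ cPOf d N B δ := mul_nonneg hB (Real.exp_pos _).le

/-- [folklore] `1 ≤ cPOf` for `B ≥ 1`, `δ ≥ 0`. -/
theorem one_le_cPOf {B : ℝ} (hB : 1 ≤ B) {δ : ℝ} (hδ : 0 ≤ δ) : 1 ≤ cPOf d N B δ := by
  unfold cPOf
  have h2 : (1 : ℝ) ≤ Real.exp (δ * (((d : ℝ) + 1) * N)) := Real.one_le_exp (by positivity)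
  nlinarith

/-- [folklore] **`piKOf g N` DECAYS AT EVERY RATE** under the matrix bound (BND) `|pmOf g β p α q| ≤ B` with `1 ≤ B` (the window does the rest). -/
theorem decays_piKOf {B : ℝ} (hB : ∀ β p α q, |pmOf g β p α q| ≤ B) (hB1 : 1 ≤ B) {δ : ℝ} (hδ : 0 ≤ δ) :
    Decays (piKOf g N) (cPOf d N B δ) δ := by
  have hB0 : 0 ≤ B := le_trans zero_le_one hB1
  intro x x' a b
  have hpos : 0 ≤ cPOf d N B δ * Real.exp (-δ * l1 (x - x')) := mul_nonneg (cPOf_nonneg hB0 δ) (Real.exp_pos _).le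
  rcases a with α | m <;> rcases b with β | m'
  · rw [piKOf_inl_inl]
    split_ifs with h
    · have hl : l1 (x - x') ≤ ((d : ℝ) + 1) * N := by
        rw [l1_sub_symm]
        have := l1_le_of_mem_cube h
        push_cast at this
        exact this
      have he : (1 : ℝ) ≤ Real.exp (δ * (((d : ℝ) + 1) * N)) * Real.exp (-δ * l1 (x - x')) := by
        rw [← Real.exp_add]
        exact Real.one_le_exp (by nlinarith)
      calc |pmOf g β x' α x| ≤ B * 1 := by rw [mul_one]; exact hB β x' α x
        _ ≤ B * (Real.exp (δ * (((d : ℝ) + 1) * N)) * Real.exp (-δ * l1 (x - x'))) := mul_le_mul_of_nonneg_left he hB0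
        _ = cPOf d N B δ * Real.exp (-δ * l1 (x - x')) := by unfold cPOf; ring
    · rw [abs_zero]; exact hpos
  · rw [piKOf_inl_inr, abs_zero]; exact hpos
  · rw [piKOf_inr_inl, abs_zero]; exact hpos
  · rw [piKOf_inr_inr]
    split_ifs with h
    · rw [h.1, sub_self, abs_one]
      have h0 : l1 (0 : Fin (d + 1) → ℤ) = 0 := by simp [l1]
      rw [h0, mul_zero, Real.exp_zero, mul_one]
      exact one_le_cPOf hB1 hδ
    · rw [abs_zero]; exact hpos

/-- [folklore] `piKOf g N` is spread under (BND). -/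
theorem spr_piKOf {B : ℝ} (hB : ∀ β p α q, |pmOf g β p α q| ≤ B) (hB1 : 1 ≤ B) : Spr (piKOf g N) :=
  ⟨cPOf d N B 1, 1, one_pos, decays_piKOf hB hB1 zero_le_one⟩

/-- [folklore] So is its transpose. -/
theorem spr_trK_piKOf {B : ℝ} (hB : ∀ β p α q, |pmOf g β p α q| ≤ B) (hB1 : 1 ≤ B) : Spr (trK (piKOf g N)) :=
  (spr_piKOf hB hB1).trK

/-- [folklore] **`piKOf g N` IS BLOCK-TRANSLATION INVARIANT** under the coarse-shift letter (SH) `pmOf g β (p + N•z) α (q + N•z) = pmOf g β p α q`. -/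
theorem shiftK_piKOf (hSH : ∀ β p α (q z : Fin (d + 1) → ℤ), pmOf g β (p + (N : ℤ) • z) α (q + (N : ℤ) • z) = pmOf g β p α q)
    (t : Fin (d + 1) → ℤ) : shiftK (-((N : ℤ) • t)) (piKOf g N) = piKOf g N := by
  funext x x' a b
  show piKOf g N (x + -((N : ℤ) • t)) (x' + -((N : ℤ) • t)) a b = piKOf g N x x' a b
  rcases a with α | m <;> rcases b with β | m'
  · rw [piKOf_inl_inl, piKOf_inl_inl, add_sub_add_right_eq_sub,
      show -((N : ℤ) • t) = (N : ℤ) • (-t) from (smul_neg _ _).symm, hSH]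
  · rfl
  · rfl
  · rw [piKOf_inr_inr, piKOf_inr_inr]
    simp only [add_left_inj]

end PiKOf

/-! ## §2 The dressings in comp form over the slot -/

section CompOf

variable (g : Form1 (d + 1) ℝ → Form0 (d + 1) ℝ) (N : ℕ)

/-- [folklore] **THE DRESSING OF A KERNEL OVER A GAUGE SLOT** (comp form): `dressKOf g N K := Π̂∘K∘Π̂ᵀ`, `Π̂ = piKOf g N`. -/
def dressKOf (K : MKer (d + 1) (Fib d)) : MKer (d + 1) (Fib d) := comp (comp (piKOf g N) K) (trK (piKOf g N))

/-- [folklore] **THE CO-DRESSED KERNEL OVER A GAUGE SLOT** `coDressKOf g N K := Π̂ᵀ∘K∘Π̂`. -/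
def coDressKOf (K : MKer (d + 1) (Fib d)) : MKer (d + 1) (Fib d) := comp (comp (trK (piKOf g N)) K) (piKOf g N)

/-- [folklore] `coDressKOf` unfolds. -/
theorem coDressKOf_eq (K : MKer (d + 1) (Fib d)) : coDressKOf g N K = comp (comp (trK (piKOf g N)) K) (piKOf g N) := rfl

/-- [folklore] `dressKOf` unfolds. -/
theorem dressKOf_eq (K : MKer (d + 1) (Fib d)) : dressKOf g N K = comp (comp (piKOf g N) K) (trK (piKOf g N)) := rfl

/-- [folklore] Right composition with `piKOf` does not touch a multiplier column. -/
theorem comp_piKOf_inr (A : MKer (d + 1) (Fib d)) (x y : Fin (d + 1) → ℤ) (a : Fib d) (μ : Fin (d + 1)) :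
    comp A (piKOf g N) x y a (Sum.inr μ) = A x y a (Sum.inr μ) := by
  unfold ExpKernelCalculus.comp
  have h : ∀ y', ∑ f : Fib d, A x y' a f * piKOf g N y' y f (Sum.inr μ) = if y' = y then A x y' a (Sum.inr μ) else 0 := by
    intro y'
    rw [Fintype.sum_sum_type]
    simp only [piKOf_inl_inr, piKOf_inr_inr, mul_zero, Finset.sum_const_zero, zero_add]
    by_cases hy : y' = y
    · simp only [hy, true_and, mul_ite, mul_one, mul_zero, Finset.sum_ite_eq', Finset.mem_univ, if_true]
    · simp [hy]
  simp_rw [h]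
  rw [tsum_point']

/-- [folklore] The `ℋ`-column of the co-dressed kernel is the windowed `Π̂`-image of the `ℋ`-column of `K`. -/
theorem colH_coDressKOf (K : MKer (d + 1) (Fib d)) (μ : Fin (d + 1)) (y : Fin (d + 1) → ℤ) (κ' : Fin (d + 1))
    (u' : Fin (d + 1) → ℤ) :
    colH (coDressKOf g N K) N μ y κ' u' =
      ∑ v ∈ cube (d + 1) N, ∑ κ : Fin (d + 1), pmOf g κ' u' κ (u' - v) * colH K N μ y κ (u' - v) := by
  unfold colH
  rw [coDressKOf_eq, comp_piKOf_inr]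
  unfold ExpKernelCalculus.comp
  simp only [trK]
  have h : ∀ u, ∑ f : Fib d, piKOf g N u u' f (Sum.inl κ') * K u ((N : ℤ) • y) f (Sum.inr μ) =
      if u' - u ∈ cube (d + 1) N then
        ∑ κ : Fin (d + 1), pmOf g κ' u' κ u * K u ((N : ℤ) • y) (Sum.inl κ) (Sum.inr μ) else 0 := fun u =>
    sum_piKOf_col_inl g N u u' κ' (fun f => K u ((N : ℤ) • y) f (Sum.inr μ))
  simp_rw [h]
  rw [tsum_window']

variable {g N}

/-- [folklore] The co-dressed kernel decays under (BND) (`1 ≤ N` not needed: the window is part of the definition). -/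
theorem decays_coDressKOf {B : ℝ} (hB : ∀ β p α q, |pmOf g β p α q| ≤ B) (hB1 : 1 ≤ B)
    {K : MKer (d + 1) (Fib d)} (hK : ∃ δ C : ℝ, 0 < δ ∧ 0 ≤ C ∧ Decays K C δ) :
    ∃ δ C : ℝ, 0 < δ ∧ 0 ≤ C ∧ Decays (coDressKOf g N K) C δ := by
  obtain ⟨δ, C, hδ, -, hK⟩ := hK
  have hPt : Decays (trK (piKOf g N)) (cPOf d N B δ) δ := decays_trK (decays_piKOf hB hB1 hδ.le)
  have h1 := BalabanStepJetsSucc.decays_comp hPt hK (show 0 ≤ δ / 2 by linarith) (show δ / 2 < δ by linarith)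
  have hP : Decays (piKOf g N) (cPOf d N B (δ / 2)) (δ / 2) := decays_piKOf hB hB1 (by linarith)
  have h2 := BalabanStepJetsSucc.decays_comp h1 hP (show 0 ≤ δ / 4 by linarith) (show δ / 4 < δ / 2 by linarith)
  exact ⟨δ / 4, _, by linarith, h2.nonneg (Sum.inl 0), h2⟩

/-- [folklore] The co-dressed kernel of a spread kernel is spread (under (BND)). -/
theorem spr_coDressKOf {B : ℝ} (hB : ∀ β p α q, |pmOf g β p α q| ≤ B) (hB1 : 1 ≤ B) {K : MKer (d + 1) (Fib d)} (hK : Spr K) :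
    Spr (coDressKOf g N K) :=
  spr_comp (spr_comp (spr_trK_piKOf hB hB1) hK) (spr_piKOf hB hB1)

/-- [folklore] Block-translation covariance of the co-dressed kernel under (SH). -/
theorem shiftK_coDressKOf (hSH : ∀ β p α (q z : Fin (d + 1) → ℤ), pmOf g β (p + (N : ℤ) • z) α (q + (N : ℤ) • z) = pmOf g β p α q)
    {K : MKer (d + 1) (Fib d)} (hKs : ∀ t : Fin (d + 1) → ℤ, shiftK (-((N : ℤ) • t)) K = K) (t : Fin (d + 1) → ℤ) :
    shiftK (-((N : ℤ) • t)) (coDressKOf g N K) = coDressKOf g N K := by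
  rw [coDressKOf_eq, ← ExpKernelCalculus.comp_shiftK, ← ExpKernelCalculus.comp_shiftK, ← trK_shiftK, shiftK_piKOf hSH, hKs]

end CompOf

/-! ## §3 Reflection invariance over the slot (centred window, `N` odd in the comb instance — here only the letters) -/

section ReflOf

variable {g : Form1 (d + 1) ℝ → Form0 (d + 1) ℝ} {N : ℕ}

/-- [folklore] **`refK (Φ N α) (piKOf g N) = piKOf g N`** under the reflection letter (RFL) and the two window letters (WIN), (WIN′) — the proof of
`refK_piKBm` with `pmBm_refl` ∕ `window_of_pmBm_ne_zero` ∕ `window_refl_of_pmBm_ne_zero` replaced by the letters. -/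
theorem refK_piKOf (α : Fin (d + 1))
    (hRFL : ∀ (b : Fin (d + 1)) (p : Fin (d + 1) → ℤ) (a : Fin (d + 1)) (q : Fin (d + 1) → ℤ),
      pmOf g b p a q = reflSign α a * reflSign α b * pmOf g b (bref α b p) a (bref α a q))
    (hWIN : ∀ {b : Fin (d + 1)} {p : Fin (d + 1) → ℤ} {a : Fin (d + 1)} {q : Fin (d + 1) → ℤ}, pmOf g b p a q ≠ 0 → p - q ∈ cube (d + 1) N)
    (hWIN' : ∀ {b : Fin (d + 1)} {p : Fin (d + 1) → ℤ} {a : Fin (d + 1)} {q : Fin (d + 1) → ℤ},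
      pmOf g b p a q ≠ 0 → bref α b p - bref α a q ∈ cube (d + 1) N) :
    refK (Φ N α) (piKOf g N) = piKOf g N := by
  funext x x' a b
  rw [refK_apply]
  rcases a with a | m <;> rcases b with b | m'
  · simp only [Φ_s_inl, Φ_r_inl, piKOf_inl_inl]
    by_cases h0 : pmOf g b x' a x = 0
    · have h0' : pmOf g b (bref α b x') a (bref α a x) = 0 := by
        have e := hRFL b x' a x
        rw [h0] at e
        have hsa := reflSign_mul_self α a
        have hsb := reflSign_mul_self α b
        have : reflSign α a * reflSign α b ≠ 0 := by
          intro hz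
          have := congrArg (fun t => t * (reflSign α a * reflSign α b)) hz
          simp only [zero_mul] at this
          nlinarith [hsa, hsb]
        rcases mul_eq_zero.1 e.symm with h1 | h1
        · exact absurd h1 this
        · exact h1
      rw [h0']
      split_ifs <;> simp [h0]
    · rw [if_pos (hWIN' h0), if_pos (hWIN h0), hRFL b x' a x]
  · simp [piKOf_inl_inr]
  · simp [piKOf_inr_inl]
  · simp only [Φ_s_inr, Φ_r_inr, piKOf_inr_inr]
    by_cases hm : m = m'
    · subst hm
      rw [reflSign_mul_self, one_mul]
      by_cases hx : x = x'
      · subst hx; simp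
      · have hx' : mref N α m x ≠ mref N α m x' := fun e => hx (mref_inj.1 e)
        simp [hx, hx']
    · simp [hm]

/-- [folklore] **REFLECTION INVARIANCE OF THE CO-DRESSED KERNEL OVER THE SLOT**: `Π̂` spread (BND), reflection-invariant (RFL∕WIN∕WIN′), `K` spread and
reflection-invariant ⟹ `refK (Φ N α) (coDressKOf g N K) = coDressKOf g N K`. -/
theorem refK_coDressKOf {B : ℝ} (hB : ∀ β p α q, |pmOf g β p α q| ≤ B) (hB1 : 1 ≤ B) {K : MKer (d + 1) (Fib d)} (hK : Spr K)
    (α : Fin (d + 1)) (hP : refK (Φ N α) (piKOf g N) = piKOf g N) (hKr : refK (Φ N α) K = K) :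
    refK (Φ N α) (coDressKOf g N K) = coDressKOf g N K := by
  have sP : Spr (piKOf g N) := spr_piKOf hB hB1
  have sPt : Spr (trK (piKOf g N)) := spr_trK_piKOf hB hB1
  rw [coDressKOf_eq, ← comp_refK (Φ N α) (fun x z a f b => slice_tame (spr_comp sPt hK).tame sP.tame x z a f b),
    ← comp_refK (Φ N α) (fun x z a f b => slice_tame sPt.tame hK.tame x z a f b), refK_trK, hP, hKr]

end ReflOf

/-! ## §4 THE COMB INSTANCE: `g := (A ↦ bmGaugeAt ρ A N)` — bridges by `rfl`, letters by name, the landed facts re-derived through the slot -/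

section Comb

variable (ρ : Fin (d + 1) → ℤ) (N : ℕ)

/-- [folklore] **BRIDGE**: the slot matrix at the comb's block-mean gauge IS `pmBm`. -/
theorem pmOf_bmGaugeAt : pmOf (fun A => bmGaugeAt ρ A N) = pmBm (n := d + 1) ρ N := rfl

/-- [folklore] **BRIDGE**: the slot kernel at the comb's block-mean gauge IS `piKBm`. -/
theorem piKOf_bmGaugeAt : piKOf (fun A => bmGaugeAt ρ A N) N = piKBm (d := d) ρ N := rfl

/-- [folklore] **BRIDGE**: the slot dressing at the comb's gauge IS `dressKBmAt`. -/
theorem dressKOf_bmGaugeAt (K : MKer (d + 1) (Fib d)) : dressKOf (fun A => bmGaugeAt ρ A N) N K = dressKBmAt ρ N K := rfl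

/-- [folklore] **BRIDGE**: the slot co-dressing at the comb's gauge IS `coDressKBmAt`. -/
theorem coDressKOf_bmGaugeAt (K : MKer (d + 1) (Fib d)) : coDressKOf (fun A => bmGaugeAt ρ A N) N K = coDressKBmAt ρ N K := rfl

variable {N}

/-- [folklore] (BND) for the comb, in-block root: an2's `abs_pmBm_le` BY NAME. -/
theorem bnd_comb (hN : 1 ≤ N) {r : Fin (d + 1) → ℕ} (hr : r ∈ box (d + 1) N) (β : Fin (d + 1)) (p : Fin (d + 1) → ℤ)
    (α : Fin (d + 1)) (q : Fin (d + 1) → ℤ) :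
    |pmOf (fun A => bmGaugeAt (toSite r) A N) β p α q| ≤ 1 + 4 * (((d : ℝ) + 1) * N) := abs_pmBm_le hN hr β p α q

/-- [folklore] `1 ≤ 1 + 4(d+1)N`. -/
theorem one_le_comb_bound (N : ℕ) : (1 : ℝ) ≤ 1 + 4 * (((d : ℝ) + 1) * N) := by
  have : (0 : ℝ) ≤ ((d : ℝ) + 1) * N := by positivity
  linarith

/-- [folklore] (SH) for the comb, any root: an2's `pmBm_shift` BY NAME. -/
theorem sh_comb (hN : 1 ≤ N) (β : Fin (d + 1)) (p : Fin (d + 1) → ℤ) (α : Fin (d + 1)) (q z : Fin (d + 1) → ℤ) :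
    pmOf (fun A => bmGaugeAt ρ A N) β (p + (N : ℤ) • z) α (q + (N : ℤ) • z) = pmOf (fun A => bmGaugeAt ρ A N) β p α q :=
  pmBm_shift ρ hN β p α q z

/-- [folklore] CONSISTENCY: the comb gauge inhabits (BND) with `B = 1 + 4(d+1)N`, so the slot kernel AT THE COMB decays at every rate with an2's
constant `cPb` (this is `decays_piKBm` read through `piKOf_bmGaugeAt` ∕ `cPOf_comb`; stated on the slot object, the landed lemma is not restated). -/
theorem decays_piKOf_comb (hN : 1 ≤ N) {r : Fin (d + 1) → ℕ} (hr : r ∈ box (d + 1) N) {δ : ℝ} (hδ : 0 ≤ δ) :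
    Decays (piKOf (fun A => bmGaugeAt (toSite r) A N) N) (cPb d N δ) δ := by
  rw [← cPOf_comb]
  exact decays_piKOf (bnd_comb hN hr) (one_le_comb_bound N) hδ

/-- [folklore] CONSISTENCY: the comb gauge inhabits (SH), so the slot kernel at the comb is block-translation invariant (= `shiftK_piKBm`). -/
theorem shiftK_piKOf_comb (hN : 1 ≤ N) (t : Fin (d + 1) → ℤ) :
    shiftK (-((N : ℤ) • t)) (piKOf (fun A => bmGaugeAt ρ A N) N) = piKOf (fun A => bmGaugeAt ρ A N) N :=
  shiftK_piKOf (sh_comb ρ hN) t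

/-- [folklore] CONSISTENCY: `shiftK_coDressKBmAt` read on the slot object at the comb gauge. -/
theorem shiftK_coDressKOf_comb (hN : 1 ≤ N) {K : MKer (d + 1) (Fib d)} (hKs : ∀ t : Fin (d + 1) → ℤ, shiftK (-((N : ℤ) • t)) K = K)
    (t : Fin (d + 1) → ℤ) :
    shiftK (-((N : ℤ) • t)) (coDressKOf (fun A => bmGaugeAt ρ A N) N K) = coDressKOf (fun A => bmGaugeAt ρ A N) N K :=
  shiftK_coDressKOf (sh_comb ρ hN) hKs t

/-- [folklore] CONSISTENCY: `decays_coDressKBmAt` read on the slot object at the comb gauge (in-block root). -/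
theorem decays_coDressKOf_comb (hN : 1 ≤ N) {r : Fin (d + 1) → ℕ} (hr : r ∈ box (d + 1) N) {K : MKer (d + 1) (Fib d)}
    (hK : ∃ δ C : ℝ, 0 < δ ∧ 0 ≤ C ∧ Decays K C δ) :
    ∃ δ C : ℝ, 0 < δ ∧ 0 ≤ C ∧ Decays (coDressKOf (fun A => bmGaugeAt (toSite r) A N) N K) C δ :=
  decays_coDressKOf (bnd_comb hN hr) (one_le_comb_bound N) hK

/-- [folklore] CONSISTENCY: the CENTRED comb gauge (`N` odd) inhabits (RFL)∕(WIN)∕(WIN′) — `pmBm_refl`, `window_of_pmBm_ne_zero`,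
`window_refl_of_pmBm_ne_zero` BY NAME — so the slot kernel at the centred comb is reflection-invariant (= `refK_piKBm`). -/
theorem refK_piKOf_comb (hN : Odd N) (α : Fin (d + 1)) :
    refK (Φ N α) (piKOf (fun A => bmGaugeAt (toSite (ctrOff (d + 1) N)) A N) N) =
      piKOf (d := d) (fun A => bmGaugeAt (toSite (ctrOff (d + 1) N)) A N) N := by
  have hN1 : 1 ≤ N := hN.pos
  have hr : ctrOff (d + 1) N ∈ box (d + 1) N := ctrOff_mem_box hN1
  exact refK_piKOf α (fun b p a q => pmBm_refl hN α b p a q) (fun h => window_of_pmBm_ne_zero hN1 hr h)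
    (fun h => window_refl_of_pmBm_ne_zero hN1 hr h α)

/-- [folklore] CONSISTENCY: `refK_coDressKBmAt_KInvStep` read on the slot object at the centred comb gauge (`Lc` odd). -/
theorem refK_coDressKOf_comb_KInvStep {Lc : ℕ} [NeZero Lc] (hLc : Odd Lc) (j : ℕ) (α : Fin (d + 1)) :
    refK (Φ Lc α) (coDressKOf (fun A => bmGaugeAt (toSite (ctrOff (d + 1) Lc)) A Lc) Lc (KInvStep (d := d) Lc j)) =
      coDressKOf (fun A => bmGaugeAt (toSite (ctrOff (d + 1) Lc)) A Lc) Lc (KInvStep (d := d) Lc j) := by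
  have hr : ctrOff (d + 1) Lc ∈ box (d + 1) Lc := ctrOff_mem_box hLc.pos
  obtain ⟨δ, C, hδ, -, hK⟩ := decays_KInvStep (d := d) (Lc := Lc) j
  exact refK_coDressKOf (bnd_comb hLc.pos hr) (one_le_comb_bound Lc) ⟨C, δ, hδ, hK⟩ α (refK_piKOf_comb hLc α) (refK_KInvStep j α)

end Comb

end

end Summit.QuantumFields.BalabanUV.Beta.AxialDressingRooted
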